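import Summits.RiemannHypothesis.RiemannHypothesis.Theorems.TiltedLandingLaw421R3FLink

/-!
# FLinkSeam — C3 g53 (W-09 «analysis»): §3″ the SEAM-BINDERED lateral gain law (PREPARED, UNASKED; files-only statement custody)

ONE tree import (`…R3FLink` = C3 v4d, LAND #1237); namespace `RhW08.FLinkSeam`; no `sorry`, no new axioms, no instances / notation.

WHY.  The typed gain sockets of record — v4d §3′ `RhW08.FLink.FLinkBoxSig' θ` (this lineage) and C4's `RemainderGainBoxSig θ` (FLinkGain image,
RSV-87) — carry NO level-`j` box seam among their binders, while the sink they feed, `RhW08.FLink.FarFieldModulusLawBoxPl lam`, DOES carry it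
(`LevelRemainderBox η f x₀ s hmax R j`, its 9th binder) and the v4d kernel `farFieldModulusLawBoxPl_of_fLinkBox` simply does not hand it to the gain
law.  Every model bench of the gain law (g52 `gainbench.py`, g53 `lowgain.py` / `corner53.py`) imposes exactly that seam as «legality» of the
level-`j` far configuration.  So the benches are evidence for the SEAM-BINDERED statement below, which is WEAKER than §3′ (implied by it,
`fLinkBoxSeam_of_fLinkBox`) and feeds the SAME sink by the SAME three-line triangle (`farFieldModulusLawBoxPl_of_fLinkBoxSeam`): nothing downstream
changes.  Without the seam the level-`j` far configuration is constrained only through `f` (clause 16 at level 0 + heredity), and the g53 bench shows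
what an unconstrained heavy window-edge cluster does: legal-but-UNCHARGED rows reach lateral gain `+.12·η/s > θ = .118` (memo LOWGAIN §4 (N)); whether
a CHARGED far level of a derivative of a legal frame can carry such a cluster is the open INFALL question that made v4b's ∀-seam
`RemainderBoxHereditySig` withdraw.  The seam-bindered form does not bet on it.

CONTENTS.  (T) `FLinkBoxSeamSig' θ` — §3′ verbatim with the binder `LevelRemainderBox η f x₀ s hmax R j →` inserted where the sink has it;
(K) `fLinkBoxSeam_of_fLinkBox : FLinkBoxSig' θ → FLinkBoxSeamSig' θ`; (K) `farFieldModulusLawBoxPl_of_fLinkBoxSeam : FLinkBoxSeamSig' θ →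
FarFieldModulusLawBoxPl (1 + θ)`; (K) `tModAllowanceBoxPl_of_fLinkBoxSeam` (the named sink `TModAllowanceBoxPlSig` for `0 ≤ θ`, `(1+θ)² ≤ 5/4`);
no converse is claimed (the gain form compares the two points `w` and `p₀ = Re v + i·Im w` of one level; the plumbed law bounds `w` alone).  For C4's
socket the same one-binder insertion (`RemainderGainBoxSeamSig θ`, not typed here — C4's names) and `hRB` passed on in
`farFieldModulusLawBoxPl_of_remainderGainBox` would do.

Nothing here bears on the truth of RH; §3′, §3″, the box modulus laws and every books law remain typed OPEN; the seam is a hypothesis; RH is not proved.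
-/

noncomputable section

namespace RhW08.FLinkSeam

open Complex Metric
open scoped ComplexConjugate
open RhW08.Round1 RhW08.StSwap RhW08.Round2 RhW08.QuadW
open RhW08.SealSwap (PBot)
open RhW08.SealSwapQ RhW08.RateSplit RhW08.IsolatedTilt RhW08.FarStep RhW08.BurgersRate RhW08.PurseP RhW08.BurgersRateG3
open RhIdea6.G17.W07C7 RhIdea6.G17.W07C7.Rev6 RhIdea6.G18.W07C8.Law421BirthS RhIdea6.G19.W07C11.Seam
open RhIdea6.G20.W07C12.Frac RhIdea6.G20.W07C12.StColP RhW07.C12.FieldSplit RhIdea6.G21.W07C13.TentMax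
open RhW07.C14.TwoSided RhW07.C14.Classes RhW07.C14.Lineage RhW07.C14.Booking
open RhW08.FLink

/-- §3″ (T, OPEN) **LATERAL GAIN LAW, BOX- AND SEAM-BINDERED** `FLinkBoxSeamSig' θ`: v4d §3′ `FLinkBoxSig' θ` with the level-`j` box seam
`LevelRemainderBox η f x₀ s hmax R j` as an extra hypothesis (placed as in `FarFieldModulusLawBoxPl`).  Model evidence (g52 ADD-3, g53 RESULT-1/2) is
evidence for THIS statement: sup lateral gain `+.025·η/s` against the allowance `θ = .118`, 0 violators in ≈ 1 650 charged rows / 400 000 grid rows. -/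
def FLinkBoxSeamSig' (θ : ℝ) : Prop :=
  ∀ (η : ℝ) (f : ℂ → ℂ) (x₀ s hmax R Hs : ℝ) (B : ℕ), EngineHyps5 2 η f x₀ s hmax R Hs B →
    ∀ (j : ℕ) (v w : ℂ), FarLevelQ η f x₀ s hmax R Hs B j → Charged (PTrkSQ PBot) StTrkDQ ReadyR2 η f x₀ s hmax R Hs B j →
      IsLowest StTrkDQ η f x₀ s hmax R Hs B j v → |v.re - x₀| ≤ R / 2 → v.im ≤ hmax → LevelRemainderBox η f x₀ s hmax R j →
      iteratedDeriv j f w ≠ 0 → (∀ z : ℂ, iteratedDeriv j f z = 0 → |z.re - v.re| < R / 2 → z = v ∨ z = conj v) →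
      iteratedDeriv (j + 1) f w = 0 → 0 < w.im → ‖w - (v.re : ℂ)‖ ≤ |v.im| →
        ‖farFieldAt f j v w‖ ≤
          ‖levelField f j (linePt v w)
              - ∑ᶠ u ∈ {u : ℂ | iteratedDeriv j f u = 0 ∧ |u.re - v.re| < R / 2},
                  ((analyticOrderAt (iteratedDeriv j f) u).toNat : ℂ) * (linePt v w - u)⁻¹‖ + θ * η / s

/-- (K) §3′ implies §3″ (drop the seam binder). -/
theorem fLinkBoxSeam_of_fLinkBox {θ : ℝ} (h : FLinkBoxSig' θ) : FLinkBoxSeamSig' θ :=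
  fun η f x₀ s hmax R Hs B hE j v w hfar hch hlow hcol hh _hRB hw0 hiso hw1 hwim hdisc =>
    h η f x₀ s hmax R Hs B hE j v w hfar hch hlow hcol hh hw0 hiso hw1 hwim hdisc

/-- ★ (K) **§3″ ALONE GIVES THE PLUMBED BOX MODULUS LAW at `λ = 1 + θ`** — v4d's triangle with the seam handed to BOTH legs. -/
theorem farFieldModulusLawBoxPl_of_fLinkBoxSeam {θ : ℝ} (hG : FLinkBoxSeamSig' θ) : FarFieldModulusLawBoxPl (1 + θ) := by
  intro η f x₀ s hmax R Hs B hE j v w hfar hch hlow hcol hh hRB hw0 hiso hw1 hwim hdisc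
  have h1 := lineRemainderAt_of_levelRemainderBox hE hRB hlow hcol hh hw0 hiso hwim hdisc
  have h2 := hG η f x₀ s hmax R Hs B hE j v w hfar hch hlow hcol hh hRB hw0 hiso hw1 hwim hdisc
  have h3 : (1 + θ) * η / s = η / s + θ * η / s := by ring
  rw [h3]
  linarith

/-- (K) … hence the NAMED SINK `TModAllowanceBoxPlSig` from §3″ alone, for `0 ≤ θ` and `(1+θ)² ≤ 5/4`. -/
theorem tModAllowanceBoxPl_of_fLinkBoxSeam {θ : ℝ} (hG : FLinkBoxSeamSig' θ) (hθ : 0 ≤ θ) (hθ2 : (1 + θ) ^ 2 ≤ 5 / 4) :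
    TModAllowanceBoxPlSig :=
  ⟨1 + θ, by linarith, hθ2, farFieldModulusLawBoxPl_of_fLinkBoxSeam hG⟩

end RhW08.FLinkSeam

end
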